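import Mathlib.Analysis.Matrix.Spectrum
import Mathlib.LinearAlgebra.Matrix.ToLinearEquiv
import Literature.MathematicalPhysics.QuantumLattice.HubbardWave0LiebProofs
import Literature.MathematicalPhysics.QuantumLattice.StabilityFinalArgumentProofs
import Literature.Computability.AlgebraicComplexity.QuantumFunctionalsDegenerationProofs
import Literature.MathematicalPhysics.QuantumLattice.HubbardModel

/-!
# Route `BalabanIR`, crux 5 `BirEveryGroundState` (item `stmt-HubbardSuperconductivity-2083`):
# the exceptional couplings of an affine Hermitian pencil are finite

Selection half of the crux card `Cruxes/BirEveryGroundState/Ideas/integer-pencil-schur-residue.md`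
(its `stub_transc` / `TranscendentalMaximisesDistinctEigenvalues`, in the form the line uses):
for Hermitian `T`, `D` the number of DISTINCT eigenvalues of `T + u D` (`u ∈ ℝ`) is maximal
outside a FINITE set of couplings (`exists_finset_forall_card_roots_le`); hence for a countable
family of such pencils (one for each torus side `L`) every open window `(U₁, U₂)` contains ONE
coupling that is simultaneously non-exceptional for every member
(`exists_mem_Ioo_forall_card_roots_le`; for the pure Hubbard tori `hubbardTorus 2 L 1 U =
hubbardTorus 2 L 1 0 + U · Σ_x n_{x↑} n_{x↓}`: `exists_coupling_forall_card_roots_le_hubbardTorus`).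

Proof (Hermite–Sylvester, no resolvents): a Hermitian `A` with eigenvalues `λ₁, …, λ_N` has at
least `k` distinct eigenvalues iff the `k × k` HANKEL matrix of power sums
`(tr A^{a+b})_{a,b<k} = (Σᵢ λᵢ^{a+b})` is non-singular (`det_powerSumHankel_ne_zero_iff`:
its kernel vectors are the coefficient vectors of polynomials of degree `< k` vanishing at
every eigenvalue); and `u ↦ det (tr (T + u D)^{a+b})_{a,b<k}` is a polynomial in `u`
(`exists_polynomial_eval_eq_det_powerSumHankel`), non-zero at a coupling of maximal count,
hence with finitely many zeros. Kato, *Perturbation Theory for Linear Operators* (1966), Ch. II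
§1.1 (algebraic dependence: finitely many exceptional points); Gantmacher, *Theory of Matrices*
II, Ch. XV §9 (Hankel forms and the number of distinct roots). Everything is folklore; no
definition is introduced.
Rev-5 MATERIALISATION RULE of the route: this module imports no route file (`…Theses.BalabanIR`)
and no Theorems module that does, so that Theses-free CLOSING modules of the crux may import it
(the countable-miss step is the private `exists_mem_Ioo_forall_not_mem_of_countable` below).
-/

noncomputable section

namespace Summit.HubbardSuperconductivity.HubbardSuperconductivity.Theorems

open Matrix Finset Polynomial
open Literature.MathematicalPhysics.QuantumLattice
open scoped ComplexOrder

/-! ### Power sums of a Hermitian matrix and the Hankel criterion -/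

section Hankel

variable {n : Type*} [Fintype n] [DecidableEq n]

omit [DecidableEq n] in
/-- **Hankel criterion** (Hermite–Sylvester). For reals `λ : n → ℝ` and `k`, the `k × k` Hankel
matrix of power sums `(Σᵢ λᵢ^{a+b})_{a,b<k}` is non-singular iff `λ` takes at least `k`
distinct values. (A kernel vector `x` is the coefficient vector of a polynomial `q` of degree
`< k` with `Σᵢ q(λᵢ)² = xᵀ H x = 0`, i.e. vanishing at every `λᵢ`; conversely
`∏_μ (X - μ)` over the distinct values is such a `q` when there are fewer than `k` of them.)
Gantmacher, *Theory of Matrices* II, Ch. XV §9. [folklore] -/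
theorem det_powerSumHankel_ne_zero_iff (lam : n → ℝ) (k : ℕ) :
    (Matrix.of fun a b : Fin k => ∑ i, lam i ^ (a.val + b.val)).det ≠ 0 ↔
      k ≤ (Finset.univ.image lam).card := by
  set H : Matrix (Fin k) (Fin k) ℝ := Matrix.of fun a b : Fin k => ∑ i, lam i ^ (a.val + b.val)
    with hH
  -- the action of `H` on a coefficient vector `x`: `(H x)_a = Σᵢ λᵢ^a q_x(λᵢ)`
  have hHx : ∀ (x : Fin k → ℝ) (a : Fin k),
      (H *ᵥ x) a = ∑ i, lam i ^ a.val * ∑ b : Fin k, x b * lam i ^ b.val := by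
    intro x a
    simp only [hH, mulVec, dotProduct, of_apply, Finset.sum_mul, Finset.mul_sum, pow_add]
    rw [Finset.sum_comm]
    refine Finset.sum_congr rfl fun i _ => Finset.sum_congr rfl fun b _ => ?_
    ring
  constructor
  · -- fewer than `k` distinct values ⇒ singular
    intro hdet
    by_contra hlt
    push Not at hlt
    set s : Finset ℝ := Finset.univ.image lam with hs
    set q : ℝ[X] := ∏ μ ∈ s, (X - C μ) with hq
    have hqdeg : q.natDegree = s.card := natDegree_finsetProd_X_sub_C_eq_card s id
    have hqmonic : q.Monic := monic_prod_of_monic _ _ fun μ _ => monic_X_sub_C μ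
    have hqeval : ∀ i, q.eval (lam i) = 0 := fun i => by
      rw [hq, eval_prod]
      exact Finset.prod_eq_zero (Finset.mem_image_of_mem lam (Finset.mem_univ i)) (by simp)
    -- the coefficient vector of `q`
    set x : Fin k → ℝ := fun b => q.coeff b.val with hx
    have hx0 : x ≠ 0 := by
      intro h
      have h1 : x ⟨s.card, hlt⟩ = 1 := by
        show q.coeff s.card = 1
        rw [← hqdeg]
        exact hqmonic.coeff_natDegree
      rw [h] at h1
      exact zero_ne_one h1
    have hqx : ∀ i, ∑ b : Fin k, x b * lam i ^ b.val = q.eval (lam i) := fun i => by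
      rw [eval_eq_sum_range' (hqdeg.trans_lt hlt) (lam i), ← Fin.sum_univ_eq_sum_range]
    have hHx0 : H *ᵥ x = 0 := by
      funext a
      rw [hHx, Pi.zero_apply]
      exact Finset.sum_eq_zero fun i _ => by rw [hqx, hqeval, mul_zero]
    exact hdet (Matrix.exists_mulVec_eq_zero_iff.mp ⟨x, hx0, hHx0⟩)
  · -- at least `k` distinct values ⇒ non-singular
    intro hk hdet
    obtain ⟨x, hx0, hHx0⟩ := Matrix.exists_mulVec_eq_zero_iff.mpr hdet
    set q : ℝ[X] := ∑ b : Fin k, C (x b) * X ^ (b : ℕ) with hq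
    have hqeval : ∀ t : ℝ, q.eval t = ∑ b : Fin k, x b * t ^ b.val := fun t => by
      simp [hq, eval_finsetSum]
    -- `Σᵢ q(λᵢ)² = Σ_a x_a (H x)_a = 0`
    have hsq : ∑ i, (q.eval (lam i)) ^ 2 = 0 := by
      have hquad : ∑ a : Fin k, x a * (H *ᵥ x) a =
          ∑ i, (∑ b : Fin k, x b * lam i ^ b.val) ^ 2 := by
        calc ∑ a : Fin k, x a * (H *ᵥ x) a
            = ∑ a : Fin k, ∑ i, x a * (lam i ^ a.val * ∑ b : Fin k, x b * lam i ^ b.val) := by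
              simp only [hHx, Finset.mul_sum]
          _ = ∑ i, ∑ a : Fin k, x a * (lam i ^ a.val * ∑ b : Fin k, x b * lam i ^ b.val) :=
              Finset.sum_comm
          _ = ∑ i, (∑ a : Fin k, x a * lam i ^ a.val) * ∑ b : Fin k, x b * lam i ^ b.val := by
              refine Finset.sum_congr rfl fun i _ => ?_
              rw [Finset.sum_mul]
              refine Finset.sum_congr rfl fun a _ => ?_
              ring
          _ = ∑ i, (∑ b : Fin k, x b * lam i ^ b.val) ^ 2 :=
              Finset.sum_congr rfl fun i _ => by rw [sq]
      have h0 : ∑ a : Fin k, x a * (H *ᵥ x) a = 0 := by simp [hHx0]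
      simp only [hqeval]
      rw [← hquad, h0]
    have hroot : ∀ i, q.eval (lam i) = 0 := fun i => by
      have h := (Finset.sum_eq_zero_iff_of_nonneg fun j _ => sq_nonneg (q.eval (lam j))).mp hsq i
        (Finset.mem_univ i)
      exact pow_eq_zero_iff two_ne_zero |>.mp h
    -- a polynomial of degree `< k` with `≥ k` distinct roots vanishes
    have hqdeg : q.natDegree < (Finset.univ.image lam).card := by
      have hd : q.degree < k := degree_sum_fin_lt x
      by_cases hq0 : q = 0
      · rw [hq0, natDegree_zero]
        exact lt_of_lt_of_le (Nat.pos_of_ne_zero fun h => by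
          rw [h] at hk; exact absurd hk (by
            intro hk0
            have : k = 0 := Nat.le_zero.mp hk0
            subst this
            exact hx0 (funext fun b => Fin.elim0 b))) le_rfl
      · have := (natDegree_lt_iff_degree_lt hq0).mpr hd
        exact this.trans_le hk
    have hq0 : q = 0 :=
      eq_zero_of_natDegree_lt_card_of_eval_eq_zero' q (Finset.univ.image lam)
        (fun μ hμ => by
          obtain ⟨i, -, rfl⟩ := Finset.mem_image.mp hμ
          exact hroot i) hqdeg
    -- hence `x = 0`
    apply hx0
    funext b
    have hcoeff : q.coeff b.val = x b := by
      rw [hq, finsetSum_coeff]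
      simp only [coeff_C_mul_X_pow, Fin.val_inj, Finset.sum_ite_eq, Finset.mem_univ, if_true]
    rw [← hcoeff, hq0, coeff_zero, Pi.zero_apply]

end Hankel

/-! ### Affine Hermitian pencils: the exceptional set is finite -/

section Pencil

variable {n : Type*} [Fintype n] [DecidableEq n]

/-- Along the pencil `u ↦ T + u D` the Hankel determinant of power sums
`det (tr (T + u D)^{a+b})_{a,b<k}` is (the evaluation of) a polynomial in `u`. [folklore] -/
theorem exists_polynomial_eval_eq_det_powerSumHankel (T D : Matrix n n ℂ) (k : ℕ) :
    ∃ p : ℂ[X], ∀ u : ℂ, p.eval u =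
      (Matrix.of fun a b : Fin k => ((T + u • D) ^ (a.val + b.val)).trace).det := by
  let M : Matrix n n ℂ[X] := T.map C + (X : ℂ[X]) • D.map C
  refine ⟨(Matrix.of fun a b : Fin k => (M ^ (a.val + b.val)).trace).det, fun u => ?_⟩
  have hM : (evalRingHom u).mapMatrix M = T + u • D := by
    ext i j
    simp only [M, RingHom.mapMatrix_apply, Matrix.map_apply, Matrix.add_apply, Matrix.smul_apply,
      smul_eq_mul, coe_evalRingHom, eval_add, eval_mul, eval_C, eval_X]
  rw [← coe_evalRingHom, RingHom.map_det]
  congr 1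
  ext a b
  simp only [RingHom.mapMatrix_apply, Matrix.map_apply, of_apply]
  rw [AddMonoidHom.map_trace (evalRingHom u) (M ^ (a.val + b.val)), ← RingHom.mapMatrix_apply,
    map_pow, hM]

/-- The number of distinct roots of the characteristic polynomial of a Hermitian matrix is the
number of its distinct eigenvalues. [folklore] -/
theorem card_toFinset_roots_charpoly {A : Matrix n n ℂ} (hA : A.IsHermitian) :
    A.charpoly.roots.toFinset.card = (Finset.univ.image hA.eigenvalues).card := by
  rw [hA.roots_charpoly_eq_eigenvalues]
  change (Finset.univ.image (RCLike.ofReal ∘ hA.eigenvalues)).card = _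
  rw [← Finset.image_image, Finset.card_image_of_injective _ RCLike.ofReal_injective]

/-- The complex Hankel matrix of traces of powers of a Hermitian matrix is the real Hankel
matrix of power sums of its eigenvalues. [folklore] -/
theorem det_powerSumHankel_eq_ofReal {A : Matrix n n ℂ} (hA : A.IsHermitian) (k : ℕ) :
    (Matrix.of fun a b : Fin k => (A ^ (a.val + b.val)).trace).det =
      (((Matrix.of fun a b : Fin k => ∑ i, hA.eigenvalues i ^ (a.val + b.val)).det : ℝ) : ℂ) := by
  have h := RingHom.map_det Complex.ofRealHom
    (Matrix.of fun a b : Fin k => ∑ i, hA.eigenvalues i ^ (a.val + b.val))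
  rw [Complex.ofRealHom_eq_coe] at h
  rw [h]
  congr 1
  ext a b
  simp only [RingHom.mapMatrix_apply, Matrix.map_apply, of_apply, Complex.ofRealHom_eq_coe,
    Literature.Computability.AlgebraicComplexity.trace_pow_eq_sum_eigenvalues_pow hA]
  push_cast
  rfl

/-- **The exceptional couplings of an affine Hermitian pencil are finite** (Kato's "finitely
many exceptional points" for algebraic dependence on the parameter). For Hermitian `T`, `D`
there is a finite set `S ⊂ ℝ` such that at every coupling `u ∉ S` the number of DISTINCT
eigenvalues of `T + u D` is maximal among all real couplings. Proof: with `k` the maximal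
count, `u ↦ det (tr (T + u D)^{a+b})_{a,b<k}` is a polynomial (`exists_polynomial_eval_eq_det_powerSumHankel`)
that is non-zero exactly where the count is `≥ k` (`det_powerSumHankel_ne_zero_iff`), and it
is non-zero at the maximiser. Kato (1966) Ch. II §1.1. [folklore] -/
theorem exists_finset_forall_card_roots_le {T D : Matrix n n ℂ} (hT : T.IsHermitian)
    (hD : D.IsHermitian) :
    ∃ S : Finset ℝ, ∀ u : ℝ, u ∉ S → ∀ u' : ℝ,
      (T + ((u' : ℝ) : ℂ) • D).charpoly.roots.toFinset.card ≤
        (T + (u : ℂ) • D).charpoly.roots.toFinset.card := by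
  set f : ℝ → ℕ := fun u => (T + (u : ℂ) • D).charpoly.roots.toFinset.card with hf
  -- a maximiser of the distinct-eigenvalue count
  have hbdd : ∀ u, f u ≤ Fintype.card n := fun u =>
    (Multiset.toFinset_card_le _).trans
      ((card_roots' _).trans (charpoly_natDegree_eq_dim (T + (u : ℂ) • D)).le)
  obtain ⟨u₀, hu₀⟩ : ∃ u₀, ∀ u, f u ≤ f u₀ := by
    have hB : BddAbove (Set.range f) := ⟨Fintype.card n, by rintro _ ⟨u, rfl⟩; exact hbdd u⟩
    obtain ⟨u₀, hu₀⟩ := Nat.sSup_mem (Set.range_nonempty f) hB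
    exact ⟨u₀, fun u => hu₀ ▸ le_csSup hB ⟨u, rfl⟩⟩
  obtain ⟨p, hp⟩ := exists_polynomial_eval_eq_det_powerSumHankel T D (f u₀)
  -- the Hankel polynomial detects the couplings of maximal count
  have hcrit : ∀ u : ℝ, p.eval (u : ℂ) ≠ 0 ↔ f u₀ ≤ f u := fun u => by
    rw [hp, det_powerSumHankel_eq_ofReal (isHermitian_add_real_smul hT hD u), Complex.ofReal_ne_zero,
      det_powerSumHankel_ne_zero_iff, ← card_toFinset_roots_charpoly]
  have hp0 : p ≠ 0 := fun h => by
    have h1 := (hcrit u₀).mpr le_rfl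
    rw [h, eval_zero] at h1
    exact h1 rfl
  refine ⟨p.roots.toFinset.image Complex.re, fun u hu u' => ?_⟩
  have hpu : p.eval (u : ℂ) ≠ 0 := fun h0 => hu (Finset.mem_image.mpr
    ⟨(u : ℂ), Multiset.mem_toFinset.mpr ((mem_roots hp0).mpr h0), Complex.ofReal_re u⟩)
  exact (hu₀ u').trans ((hcrit u).mp hpu)

/-- If each `B L ⊆ ℝ` is countable, every non-degenerate open interval contains a point outside
all of them (an open real interval is uncountable). Private copy, for the materialisation rule, of
`exists_mem_Ioo_forall_not_mem` of `BalabanIRBirEveryGroundStateSchur.lean`. [folklore] -/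
private theorem exists_mem_Ioo_forall_not_mem_of_countable {U₁ U₂ : ℝ} (h : U₁ < U₂) (B : ℕ → Set ℝ)
    (hB : ∀ L, (B L).Countable) : ∃ U ∈ Set.Ioo U₁ U₂, ∀ L, U ∉ B L := by
  by_contra hcon
  push Not at hcon
  have hsub : Set.Ioo U₁ U₂ ⊆ ⋃ L, B L := fun U hU => by
    obtain ⟨L, hL⟩ := hcon U hU
    exact Set.mem_iUnion.mpr ⟨L, hL⟩
  have hc : (Set.Ioo U₁ U₂).Countable := (Set.countable_iUnion hB).mono hsub
  have h1 : Cardinal.mk (Set.Ioo U₁ U₂) ≤ Cardinal.aleph0 := Cardinal.mk_le_aleph0_iff.2 hc.to_subtype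
  rw [Cardinal.mk_Ioo_real h] at h1
  exact not_le_of_gt Cardinal.aleph0_lt_continuum h1

/-- **One coupling for a countable family of pencils.** For Hermitian pencils
`T_L + u D_L` (`L ∈ ℕ`, sizes depending on `L`) every open window `(U₁, U₂)` contains a
coupling at which, simultaneously for every `L`, the number of distinct eigenvalues of
`T_L + u D_L` is maximal (the exceptional sets are finite, `exists_finset_forall_card_roots_le`,
and a countable union of finite sets misses a point of the window,
`exists_mem_Ioo_forall_not_mem`). [folklore] -/
theorem exists_mem_Ioo_forall_card_roots_le {ι : ℕ → Type*} [∀ L, Fintype (ι L)]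
    [∀ L, DecidableEq (ι L)] {T D : ∀ L, Matrix (ι L) (ι L) ℂ} (hT : ∀ L, (T L).IsHermitian)
    (hD : ∀ L, (D L).IsHermitian) {U₁ U₂ : ℝ} (h : U₁ < U₂) :
    ∃ U ∈ Set.Ioo U₁ U₂, ∀ (L : ℕ) (u' : ℝ),
      (T L + ((u' : ℝ) : ℂ) • D L).charpoly.roots.toFinset.card ≤
        (T L + (U : ℂ) • D L).charpoly.roots.toFinset.card := by
  choose S hS using fun L => exists_finset_forall_card_roots_le (hT L) (hD L)
  obtain ⟨U, hU, hUS⟩ := exists_mem_Ioo_forall_not_mem_of_countable h (fun L => (S L : Set ℝ))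
    fun L => (S L).countable_toSet
  exact ⟨U, hU, fun L u' => hS L U (fun hmem => hUS L hmem) u'⟩

/-- **Selection for the pure Hubbard tori** (card `integer-pencil-schur-residue`, the content
of its `stub_transc` as used by the line): `hubbardTorus 2 L 1 U = hubbardTorus 2 L 1 0 +
U · Σ_x n_{x↑} n_{x↓}` is an affine Hermitian pencil in `U` for every side `L`, so every open
window of couplings contains ONE coupling `U` at which, for EVERY `L` at once, the number of
distinct eigenvalues of `hubbardTorus 2 L 1 U` is maximal over all real couplings (no
accidental coincidence of eigenvalue branches at `U`, for any torus size). [folklore] -/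
theorem exists_coupling_forall_card_roots_le_hubbardTorus {U₁ U₂ : ℝ} (h : U₁ < U₂) :
    ∃ U ∈ Set.Ioo U₁ U₂, ∀ (L : ℕ) (u' : ℝ),
      (hubbardTorus 2 L 1 u').charpoly.roots.toFinset.card ≤
        (hubbardTorus 2 L 1 U).charpoly.roots.toFinset.card := by
  have hpen : ∀ (L : ℕ) (u : ℝ), hubbardTorus 2 L 1 u = hubbardTorus 2 L 1 0 +
      (u : ℂ) • ∑ x : FermionTorus 2 L, numberOp x 0 * numberOp x 1 := by
    intro L u
    unfold hubbardTorus hamiltonian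
    rw [Complex.ofReal_zero, zero_smul, add_zero]
  have hT : ∀ L : ℕ, (hubbardTorus 2 L 1 0).IsHermitian := fun L =>
    LiebThm1.hamiltonian_isHermitian (fermionTorusGraph 2 L) 1 0
  have hD : ∀ L : ℕ, (∑ x : FermionTorus 2 L, numberOp x 0 * numberOp x 1 :
      Matrix (Finset (Orb (FermionTorus 2 L))) (Finset (Orb (FermionTorus 2 L))) ℂ).IsHermitian := by
    intro L
    have h1 : (hubbardTorus 2 L 1 1).IsHermitian := LiebThm1.hamiltonian_isHermitian _ 1 1
    have hsub : (∑ x : FermionTorus 2 L, numberOp x 0 * numberOp x 1 :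
        Matrix (Finset (Orb (FermionTorus 2 L))) (Finset (Orb (FermionTorus 2 L))) ℂ) =
        hubbardTorus 2 L 1 1 - hubbardTorus 2 L 1 0 := by
      rw [hpen L 1, Complex.ofReal_one, one_smul, add_sub_cancel_left]
    rw [hsub]
    exact h1.sub (hT L)
  obtain ⟨U, hU, hle⟩ := exists_mem_Ioo_forall_card_roots_le
    (ι := fun L => Finset (Orb (FermionTorus 2 L))) (T := fun L => hubbardTorus 2 L 1 0)
    (D := fun L => ∑ x : FermionTorus 2 L, numberOp x 0 * numberOp x 1) hT hD h
  refine ⟨U, hU, fun L u' => ?_⟩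
  rw [hpen L u', hpen L U]
  exact hle L u'

end Pencil

end Summit.HubbardSuperconductivity.HubbardSuperconductivity.Theorems
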